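import Summits.ResolutionOfSingularities.ResolutionOfSingularities.Theorems.EquisingularLiftEquisingularLiftNatModelStep
import Literature.AlgebraicGeometry.Resolution.CanonicalResolutionSmoothCentre
import Literature.AlgebraicGeometry.Resolution.RegularLocalRingsProofs
import Summits.ResolutionOfSingularities.ResolutionOfSingularities.Theorems.EquisingularLiftEquisingularLiftNatKeyLetterCarrierRound
import Summits.ResolutionOfSingularities.ResolutionOfSingularities.Theorems.EquisingularLiftEquisingularLiftNatPreLetterPointStep
import HarnessLib

/-!
# [OURS · L1 W4.5(b) · EL♮(3) · WIDTH TABLE D5 «IMMATURE HOST», supplier row HOPEN, input (IN-3) in HOPEN part 2's spelling, model square supplied]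
# `TCPlus.keyInc_carrierRound_of_order k : hG1C′` (res-L1-w45b-stub-2 g16's `TCPlus.hopen_supplier_of`, mirror 0a6298559ee6eb59, binder `hG1C` + the model square)

res-L1-w45b-stub-4 g12.  OURS; NOT a statement of any manuscript ([Hironaka2017] is a candidate under adjudication, nothing of it is asserted); AI-written, weaker than
expert review.  No `sorry`; standard axioms; DEF-FREE.  `--supports stmt-ResolutionOfSingularities-20148 --as helper`.

WHAT.  The (IN-3) input of HOPEN part 2 (`TCPlus.hopen_supplier_of k H ι hBirth hG1P hG1C hCLw`) in the binder spelling that file pins, G1-CAR derived from the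
ORDER-ONE datum: `TCPlus.keyInc_carrierRound_of_order k` = `hG1C` with ONE supplement (STATUS 2026-08-28T22:15Z, by type): the model square `tG`, `IsPullback jG tG (σ ≫ q) (Spec θ)`
  over a residue surjection `θ` and `IsProper (σ ≫ q)` — without them the order-one datum `hgen`, which lives at the closed points of `Z` downstairs, does not
  control `𝓜` at a closed point of `supp 𝒞` outside `jG(G)` and the conclusion fails there; with them every closed point of `X` is `jG z` (proper over the local
  `O`: closed points lie over the closed point; `range jG` = that fibre), so Δ2b's order-one argument gives the cone packs of degree `1` at EVERY closed point of
  `supp 𝒞` (frame from the 2-frames, domain quotient from the regularity of `V(𝒞)`, `𝓜 ≤ 𝒞` from the G1-P membership, `Φ ≢ 0 mod c` from `hgen`), the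
  factorization `𝓜·𝒪 = 𝒞·𝒪 · St' 𝓜` follows by ✓ `comap_eq_pow_mul_strictTransformIdeal_of_packs` (p670257; `[CompactSpace X₂]` is in the binder, closed points
  descend along the proper `τ`), and ✓ `keyInc_carrierRound_of_factorization` (p672566) concludes `St' 𝓜 ≤ 𝒞·𝒪 ⊔ St' 𝓠`.  The downstairs regularity /
  codimension clauses and the trace `𝓘⟨M⟩` of the pinned binder are not used.
[cite: StacksProject, Tag 0804] [cite: GortzWedhorn2020, Prop. 13.91 and (13.19)] [folklore; pure composition of the cited tree theorems]
-/

set_option linter.dupNamespace false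
set_option linter.overlappingInstances false

noncomputable section

open CategoryTheory CategoryTheory.Limits AlgebraicGeometry TopologicalSpace Topology IsLocalRing
open Literature.AlgebraicGeometry.Resolution
open AlgebraicGeometry.Scheme.IdealSheafData

namespace Summit.ResolutionOfSingularities.ResolutionOfSingularities.Cruxes.EquisingularLiftNat.Sections

section KeyLetterCarrierRoundOfOrder

variable (k : Type) [Field k]

/-- **(IN-3) in HOPEN part 2's spelling, with the model square supplied — G1-CAR from the ORDER-ONE datum**: `hG1C` of `TCPlus.hopen_supplier_of` plus
`θ`, `tG`, `IsPullback jG tG (σ ≫ q) (Spec θ)` and `IsProper (σ ≫ q)` (see the module docstring for why they are needed and for the proof).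
[cite: StacksProject, Tag 0804] [OURS · L1 W4.5b · WIDTH TABLE D5, HOPEN (IN-3′)] -/
theorem TCPlus.keyInc_carrierRound_of_order :
    ∀ (O : Type) [CommRing O] [IsDomain O] [IsDiscreteValuationRing O] (θ : O →+* k), Function.Surjective θ → ∀ {P X X₂ G G₂ : Scheme.{0}} (σ : X ⟶ P) (Y : Set P) (q : P ⟶ Spec (.of O))
        [IsLocallyNoetherian X] [IsIntegral X] [IsLocallyNoetherian X₂] [IsIntegral X₂] [CompactSpace X₂] [IsLocallyNoetherian G] [IsIntegral G] [IsLocallyNoetherian G₂] [IsIntegral G₂]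
        [JacobsonSpace G₂] [IsProper (σ ≫ q)], Scheme.IsRegular X → ∀ (jG : G ⟶ X) (tG : G ⟶ Spec (.of k)), IsPullback jG tG (σ ≫ q) (Spec.map (CommRingCat.ofHom θ)) → ∀
        -- the CAR centre `𝒞 = 𝓢 ⊔ 𝓟` (a regular relative curve with 2-frames and reduced trace `𝓘⟨Z⟩`), the round `τ = Bl_𝒞`, `υ₂ = Bl_Z`, the new square
        (𝓢 𝓟 𝓠 𝓜 : X.IdealSheafData) {Z : Set G} (hZ : IsClosed Z), (𝓢 ⊔ 𝓟).comap jG = vanishingIdeal ⟨Z, hZ⟩ → Scheme.IsRegular (𝓢 ⊔ 𝓟).subscheme → 𝓢 ⊔ 𝓟 ≠ ⊥ →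
        (∀ x ∈ (𝓢 ⊔ 𝓟).support, ∃ c : Fin 2 → X.presheaf.stalk x, Ideal.span (Set.range c) = stalkIdeal (𝓢 ⊔ 𝓟) x ∧ IsQuasiRegular c) →
        ∀ {τ : X₂ ⟶ X}, IsBlowup τ (𝓢 ⊔ 𝓟) → ∀ {υ₂ : G₂ ⟶ G}, IsBlowup υ₂ (vanishingIdeal ⟨Z, hZ⟩) → ∀ (j₂ : G₂ ⟶ X₂), j₂ ≫ τ = υ₂ ≫ jG →
        (∀ z : ↥(vanishingIdeal (⟨Z, hZ⟩ : Closeds G)).subscheme, IsRegularLocalRing ((vanishingIdeal (⟨Z, hZ⟩ : Closeds G)).subscheme.presheaf.stalk z)) →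
        (∀ z ∈ Z, IsClosed ({z} : Set G) → IsRegularLocalRing (G.presheaf.stalk z)) →
        (∀ z ∈ Z, IsClosed ({z} : Set G) → ringKrullDim (G.presheaf.stalk z ⧸ stalkIdeal (vanishingIdeal (⟨Z, hZ⟩ : Closeds G)) z) + 2 = ringKrullDim (G.presheaf.stalk z)) →
        -- the immature key letter: principal, trace `𝓘⟨M⟩`, generic ORDER ONE along `Z`, and the G1-P membership with `2 ≤ a`
        (∀ z : X, (stalkIdeal 𝓜 z).IsPrincipal) → 𝓜 ≠ ⊥ → ∀ (M : Set G) (hM : IsClosed M), 𝓜.comap jG = vanishingIdeal ⟨M, hM⟩ →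
        (∀ z ∈ Z, IsClosed ({z} : Set G) → ¬ stalkIdeal (𝓜.comap jG) z ≤ stalkIdeal (vanishingIdeal (⟨Z, hZ⟩ : Closeds G)) z ^ 2) →
        ∀ (a : ℕ), 2 ≤ a → 𝓜 ≤ 𝓟 ^ a ⊔ 𝓟 * 𝓢 ⊔ 𝓢 * 𝓠 →
        strictTransformIdeal τ (𝓢 ⊔ 𝓟) 𝓜 ≤ (𝓢 ⊔ 𝓟).comap τ ⊔ strictTransformIdeal τ (𝓢 ⊔ 𝓟) 𝓠 := by
  intro O _ _ _ θ hθ P X X₂ G G₂ σ Y q _ _ _ _ _ _ _ _ _ _ _ hX jG tG hsq 𝓢 𝓟 𝓠 𝓜 Z hZ hCZ hCreg hC0 hfr τ hτ υ₂ _ j₂ _ _ _ _ h𝓜pr _ M hM _ hgen a ha hInc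
  classical
  haveI : IsClosedImmersion (Spec.map (CommRingCat.ofHom θ)) := IsClosedImmersion.spec_of_surjective _ hθ
  haveI hjci : IsClosedImmersion jG := MorphismProperty.IsStableUnderBaseChange.of_isPullback hsq.flip inferInstance
  haveI : IsProper τ := hτ.isProper
  -- closed points of `X₂` go to closed points of `X` along the proper `τ`
  have hτcl : ∀ x' : X₂, IsClosed ({x'} : Set X₂) → IsClosed ({τ x'} : Set X) := fun x' hx' => by
    have h := τ.isClosedMap _ hx'
    rwa [Set.image_singleton] at h
  -- closed points of `X` lie over the closed point of `O`, hence in the special fibre, at closed points of `G`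
  have hrange : ∀ p : X, IsClosed ({p} : Set X) → ∃ z : G, jG z = p ∧ IsClosed ({z} : Set G) := by
    intro p hp
    have h1 : IsClosed ({(σ ≫ q) p} : Set ↥(Spec (.of O))) := by
      have h := (σ ≫ q).isClosedMap _ hp
      rwa [Set.image_singleton] at h
    have h2 : (σ ≫ q) p = closedPoint O := by
      have h3 : closedPoint O ∈ closure ({(σ ≫ q) p} : Set ↥(Spec (.of O))) := (IsLocalRing.specializes_closedPoint ((σ ≫ q) p)).mem_closure
      rw [h1.closure_eq] at h3
      exact (Set.eq_of_mem_singleton h3).symm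
    have h4 : p ∈ Set.range jG := by
      rw [range_eq_preimage_of_isPullback hsq, range_specMap_of_surjective_of_field θ hθ]; exact h2
    obtain ⟨z, rfl⟩ := h4
    refine ⟨z, rfl, ?_⟩
    have h5 : ({z} : Set G) = jG ⁻¹' {jG z} := by
      ext z'
      simp only [Set.mem_singleton_iff, Set.mem_preimage]
      exact ⟨fun h => by rw [h], fun h => jG.isClosedEmbedding.injective h⟩
    rw [h5]; exact hp.preimage jG.continuous
  -- order ≥ 1 along the centre: the G1-P membership puts `𝓜` inside `𝒞 = 𝓢 ⊔ 𝓟` (`a ≥ 1`)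
  have hMC : 𝓜 ≤ 𝓢 ⊔ 𝓟 := by
    refine hInc.trans (sup_le (sup_le ?_ ?_) ?_)
    · calc 𝓟 ^ a = 𝓟 ^ (a - 1) * 𝓟 := by rw [← pow_succ, Nat.sub_add_cancel (by omega)]
        _ ≤ 𝓟 := pow_mul_le 𝓟 𝓟 (a - 1)
        _ ≤ 𝓢 ⊔ 𝓟 := le_sup_right
    · calc 𝓟 * 𝓢 = 𝓟 ^ 1 * 𝓢 := by rw [pow_one]
        _ ≤ 𝓢 := pow_mul_le 𝓟 𝓢 1
        _ ≤ 𝓢 ⊔ 𝓟 := le_sup_left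
    · calc 𝓢 * 𝓠 = 𝓠 ^ 1 * 𝓢 := by rw [pow_one, mul_comm]
        _ ≤ 𝓢 := pow_mul_le 𝓠 𝓢 1
        _ ≤ 𝓢 ⊔ 𝓟 := le_sup_left
  -- the degree-one cone packs at the CLOSED points of the centre's support (all of the form `jG z`, `z ∈ Z` closed): Δ2b's argument at `a = 1`
  have hpack : ∀ p ∈ (𝓢 ⊔ 𝓟).support, IsClosed ({p} : Set X) →
      ∃ (r : ℕ) (c : Fin r → X.presheaf.stalk p) (Φ : MvPolynomial (Fin r) (X.presheaf.stalk p)),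
        Ideal.span (Set.range c) = stalkIdeal (𝓢 ⊔ 𝓟) p ∧ IsQuasiRegular c ∧ IsDomain (X.presheaf.stalk p ⧸ Ideal.span (Set.range c)) ∧
        Φ.IsHomogeneous 1 ∧ MvPolynomial.map (Ideal.Quotient.mk (Ideal.span (Set.range c))) Φ ≠ 0 ∧ stalkIdeal 𝓜 p = Ideal.span {MvPolynomial.eval c Φ} := by
    intro p hp hpcl
    obtain ⟨z, rfl, hzcl⟩ := hrange p hpcl
    have hzZ : z ∈ Z := by
      have h : z ∈ ((((𝓢 ⊔ 𝓟).comap jG).support : Set G)) := by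
        rw [Scheme.IdealSheafData.support_comap]; exact hp
      rw [hCZ, Scheme.IdealSheafData.coe_support_vanishingIdeal] at h
      exact h
    obtain ⟨c, hc1, hc2⟩ := hfr _ hp
    have hdom : IsDomain (X.presheaf.stalk (jG z) ⧸ Ideal.span (Set.range c)) := by
      rw [hc1]
      haveI := isRegularLocalRing_stalk_quotient_stalkIdeal hCreg hp
      exact isDomain_of_isRegularLocalRing _
    obtain ⟨Gm, hGm⟩ := (h𝓜pr (jG z)).principal
    have hGm' : stalkIdeal 𝓜 (jG z) = Ideal.span {Gm} := hGm
    have hGa : Gm ∈ Ideal.span (Set.range c) ^ 1 := by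
      rw [pow_one, hc1]
      exact stalkIdeal_mono hMC _ (hGm' ▸ Ideal.mem_span_singleton_self Gm)
    obtain ⟨Φ, hΦd, hΦev⟩ := (Ideal.mem_span_pow_iff_exists_isHomogeneous c Gm).mp hGa
    have hK : stalkIdeal 𝓜 (jG z) = Ideal.span {MvPolynomial.eval c Φ} := by rw [hΦev]; exact hGm'
    have hΦ : MvPolynomial.map (Ideal.Quotient.mk (Ideal.span (Set.range c))) Φ ≠ 0 := by
      intro h0
      apply hgen z hzZ hzcl
      have h1 : Gm ∈ Ideal.span (Set.range c) ^ 2 := hΦev ▸ eval_mem_pow_succ_of_map_mk_eq_zero c hΦd h0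
      rw [stalkIdeal_comap_eq_map_stalkMap, hGm', Ideal.map_span, Set.image_singleton, Ideal.span_le, Set.singleton_subset_iff, ← hCZ,
        stalkIdeal_comap_eq_map_stalkMap, ← hc1, ← Ideal.map_pow]
      exact Ideal.mem_map_of_mem _ h1
    exact ⟨2, c, Φ, hc1, hc2, hdom, hΦd, hΦ, hK⟩
  have hfac : 𝓜.comap τ = (𝓢 ⊔ 𝓟).comap τ ^ 1 * strictTransformIdeal τ (𝓢 ⊔ 𝓟) 𝓜 :=
    comap_eq_pow_mul_strictTransformIdeal_of_packs τ (𝓢 ⊔ 𝓟) 𝓜 hτ 1 hτcl hpack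
  exact keyInc_carrierRound_of_factorization τ 𝓢 𝓟 𝓠 𝓜 ha hτ.isEffectiveCartier hInc hfac

end KeyLetterCarrierRoundOfOrder

end Summit.ResolutionOfSingularities.ResolutionOfSingularities.Cruxes.EquisingularLiftNat.Sections

end
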